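import Literature.Analysis.SpecialFunctions.CauchyBetaIntegral
import Literature.Analysis.FunctionSpaces.BesselJProofs
import Literature.Analysis.SpecialFunctions.InvSqAddSqIntegral
import HarnessLib

/-!
# The weight-2 Kloosterman–Bessel mode integral (Lipschitz–Hankel)

Topic `Literature/NumberTheory/LFunctions`. Everything here is PROVED (theorems only; no definition,
no named fact).

The `x`-integral that produces the Bessel function `J₁` in the Fourier expansion of the weight-2
Poincaré series (Iwaniec–Kowalski, *Analytic Number Theory*, proof of Lemma 14.2, and (3.17) of
Iwaniec, *Topics in Classical Automorphic Forms*, at `k = 2`): for `A, B, y > 0`,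

  `∫_ℝ (x+iy)⁻² e(−A/(x+iy) − B(x+iy)) dx = −2π √(B/A) · J₁(4π√(AB))`,   `e(z) = exp(2πiz)`

(`weightTwo_besselModeIntegral`, in the exact form of the stub `stub_besselModeIntegral` of the
Petersson-formula skeleton for `KowalskiMichel2000.kowalskiMichel2000_peterssonFormula`).

Proof (as printed): expand `e(−A/τ) = Σ_j (−2πiA)^j τ^{−j}/j!`, integrate termwise using the
**Lipschitz integral** `∫_{Im τ = y} τ^{−(m+2)} e(−Bτ) dx = (−2πi)^{m+2} B^{m+1}/(m+1)!`
(`besselMode_lipschitzIntegral`, `besselMode_lipschitzIntegral_line`), and resum against the power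
series of `J₁` (the tree's `besselJ`, `hasSum_besselJ_holds`):
`Σ_j (−2πiA)^j (−2πi)^{j+2} B^{j+1}/(j!(j+1)!) = −Σ_j (−1)^j (2π)^{2j+2} A^j B^{j+1}/(j!(j+1)!)`.
The Lipschitz integral is NOT obtained by residues (Mathlib has no residue theorem) but from the
tree's Hankel/Laplace inversion `∫_ℝ e^{iYt}(1+it)^{−a} dt = 2π Y^{a−1} e^{−Y}/Γ(a)`
(`Literature.Analysis.SpecialFunctions.integral_exp_mul_one_add_I_mul_cpow_neg`, itself Mathlib's
Fourier inversion theorem applied to the Gamma density) by the substitution `x = −yt`,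
`x + iy = iy(1 + it)`, with `a = m + 2`, `Y = 2πBy`. The interchange of sum and integral is
dominated convergence for series (`MeasureTheory.hasSum_integral_of_dominated_convergence`) with the
summable majorant `(2πA/y)^j/j! · e^{2πBy}/(x²+y²)`.

## References
* [IwaniecKowalski2004] H. Iwaniec, E. Kowalski, *Analytic Number Theory*, AMS Coll. Publ. 53 (2004),
  §14.2, proof of Lemma 14.2 (the integral preceding (14.13)); also §3.2 of Iwaniec's *Topics*.
* [KowalskiMichel2000] E. Kowalski, P. Michel, Acta Arith. 94 (2000), §2.4.2 p. 312 (consumer: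
  Petersson's formula at weight 2).

Mathlib: `MeasureTheory.Measure.integral_comp_div`, `MeasureTheory.hasSum_integral_of_dominated_convergence`,
`NormedSpace.expSeries_div_hasSum_exp`, `Complex.exp_eq_exp_ℂ`, `Real.summable_pow_div_factorial`,
`Complex.Gamma_nat_eq_factorial`; tree: `integrable_inv_sq_add_sq_of_ne_zero'` (`InvSqAddSqIntegral.lean`).
Tree search (`lean search 'Lipschitz|besselJ|one_add_mul_I_cpow'`): the Hankel/Laplace inversion of
`CauchyBetaIntegral.lean` is the only line-integral evaluation of this kind; no weight-2 mode integral.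
-/

noncomputable section

namespace Literature.NumberTheory.LFunctions

open _root_.MeasureTheory _root_.Set _root_.Filter _root_.Complex _root_.Real
open scoped _root_.Topology
open _root_.Literature.Analysis.FunctionSpaces (besselJ besselJTerm hasSum_besselJ_holds)
open _root_.Literature.Analysis.SpecialFunctions (integrable_inv_sq_add_sq_of_ne_zero')

/-! ## 1. The Lipschitz integral `∫_{Im τ = y} τ^{-(m+2)} e(-Bτ) dx` -/

/-- **Lipschitz's integral, real-phase form**: for `y, B > 0` and `m : ℕ`,
`∫_ℝ (x+iy)^{-(m+2)} e^{-2πiBx} dx = (−2πi)^{m+2} B^{m+1} e^{−2πBy}/(m+1)!`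
(from the tree's Hankel/Laplace inversion by `x = −yt`, `x + iy = iy(1+it)`; classically a residue
at `τ = 0`). [cite: IwaniecKowalski2004, §14.2 (proof of Lemma 14.2); folklore] -/
theorem besselMode_lipschitzIntegral (m : ℕ) {y B : ℝ} (hy : 0 < y) (hB : 0 < B) :
    ∫ x : ℝ, (((x : ℂ) + y * I) ^ (m + 2))⁻¹ * cexp (-(2 * π * I * B) * (x : ℂ)) =
      (-(2 * π * I)) ^ (m + 2) * (B : ℂ) ^ (m + 1) / ((m + 1).factorial : ℂ) *
        cexp (-(2 * π * B * y : ℝ)) := by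
  -- the tree's Hankel/Laplace inversion with `a = m + 2`, `Y = 2πBy`
  set a : ℂ := ((m + 1 : ℕ) : ℂ) + 1 with ha_def
  have ha : 1 < a.re := by
    simp only [ha_def, Complex.add_re, Complex.natCast_re, Complex.one_re]
    have : (0 : ℝ) ≤ (m : ℝ) := Nat.cast_nonneg m
    push_cast
    linarith
  set Y : ℝ := 2 * π * B * y with hY_def
  have hY : 0 < Y := by positivity
  have hT := Literature.Analysis.SpecialFunctions.integral_exp_mul_one_add_I_mul_cpow_neg ha hY
  -- `Γ(a) = (m+1)!`, `Y^(a-1) = Y^(m+1)`, `(1+tI)^(-a) = ((1+tI)^(m+2))⁻¹`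
  have hΓ : Complex.Gamma a = ((m + 1).factorial : ℂ) := by
    rw [ha_def, Complex.Gamma_nat_eq_factorial]
  have hYpow : (Y : ℂ) ^ (a - 1) = (Y : ℂ) ^ (m + 1) := by
    rw [ha_def, add_sub_cancel_right, Complex.cpow_natCast]
  have hker : ∀ t : ℝ, (1 + t * I : ℂ) ^ (-a) = ((1 + t * I : ℂ) ^ (m + 2))⁻¹ := by
    intro t
    rw [Complex.cpow_neg, ha_def]
    congr 1
    rw [show ((m + 1 : ℕ) : ℂ) + 1 = ((m + 2 : ℕ) : ℂ) by push_cast; ring, Complex.cpow_natCast]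
  rw [hΓ, hYpow] at hT
  simp_rw [hker] at hT
  -- substitution `t = x / (-y)`
  set g : ℝ → ℂ := fun t => cexp (I * Y * t) * ((1 + t * I : ℂ) ^ (m + 2))⁻¹ with hg_def
  have hsub : ∫ x : ℝ, g (x / (-y)) = (y : ℂ) * ∫ t : ℝ, g t := by
    have h := Measure.integral_comp_div g (-y)
    rw [abs_neg, abs_of_pos hy] at h
    rw [h, Complex.real_smul]
  have hy' : (y : ℂ) ≠ 0 := by exact_mod_cast hy.ne'
  have hIy : (I * y : ℂ) ≠ 0 := mul_ne_zero I_ne_zero hy'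
  have hyinv : (y : ℂ) * (y : ℂ)⁻¹ = 1 := mul_inv_cancel₀ hy'
  have hpt : ∀ x : ℝ, (((x : ℂ) + y * I) ^ (m + 2))⁻¹ * cexp (-(2 * π * I * B) * (x : ℂ)) =
      ((I * y) ^ (m + 2))⁻¹ * g (x / (-y)) := by
    intro x
    have hτ : ((x : ℂ) + y * I) ≠ 0 := by
      intro h
      have := congrArg Complex.im h
      simp [hy.ne'] at this
    have e0 : ((x / (-y) : ℝ) : ℂ) = -(x : ℂ) * (y : ℂ)⁻¹ := by rw [div_neg]; push_cast; ring
    have e1 : (1 + ((x / (-y) : ℝ) : ℂ) * I : ℂ) = ((x : ℂ) + y * I) / (I * y) := by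
      rw [eq_div_iff hIy, e0]
      linear_combination (-(x : ℂ) * I ^ 2) * hyinv + (-(x : ℂ)) * Complex.I_sq
    have e2 : I * (Y : ℂ) * ((x / (-y) : ℝ) : ℂ) = -(2 * π * I * B) * (x : ℂ) := by
      rw [hY_def, e0]
      push_cast
      linear_combination (-(2 * π * I * B * x : ℂ)) * hyinv
    simp only [hg_def]
    rw [e1, e2, div_pow]
    field_simp
  simp_rw [hpt]
  rw [integral_const_mul, hsub, hT]
  have key : ((I * (y : ℂ)) ^ (m + 2))⁻¹ * ((y : ℂ) * (2 * π) * (Y : ℂ) ^ (m + 1)) =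
      (-(2 * π * I)) ^ (m + 2) * (B : ℂ) ^ (m + 1) := by
    have hnegI : (-(2 * π * I) : ℂ) ^ (m + 2) = (2 * π : ℂ) ^ (m + 2) * (I ^ (m + 2))⁻¹ := by
      rw [← inv_pow, Complex.inv_I, ← mul_pow]
      congr 1
      ring
    rw [hnegI, hY_def]
    push_cast
    rw [mul_pow I (y : ℂ) (m + 2), mul_inv]
    field_simp
    ring
  calc ((I * (y : ℂ)) ^ (m + 2))⁻¹ * ((y : ℂ) * (2 * π * ((Y : ℂ) ^ (m + 1) * cexp (-(Y : ℂ))) /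
          ((m + 1).factorial : ℂ)))
        = ((I * (y : ℂ)) ^ (m + 2))⁻¹ * ((y : ℂ) * (2 * π) * (Y : ℂ) ^ (m + 1)) *
            cexp (-(Y : ℂ)) / ((m + 1).factorial : ℂ) := by ring
    _ = (-(2 * π * I)) ^ (m + 2) * (B : ℂ) ^ (m + 1) * cexp (-(Y : ℂ)) / ((m + 1).factorial : ℂ) := by
          rw [key]
    _ = _ := by ring

/-- **Lipschitz's integral on the line `Im τ = y`**: for `y, B > 0` and `m : ℕ`,
`∫_ℝ (x+iy)^{-(m+2)} e(−B(x+iy)) dx = (−2πi)^{m+2} B^{m+1}/(m+1)!` — independent of `y`, as the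
residue computation `−2πi · Res_{τ=0} τ^{−(m+2)} e^{−2πiBτ}` predicts.
[cite: IwaniecKowalski2004, §14.2 (proof of Lemma 14.2); folklore] -/
theorem besselMode_lipschitzIntegral_line (m : ℕ) {y B : ℝ} (hy : 0 < y) (hB : 0 < B) :
    ∫ x : ℝ, (((x : ℂ) + y * I) ^ (m + 2))⁻¹ * cexp (-(2 * π * I) * B * ((x : ℂ) + y * I)) =
      (-(2 * π * I)) ^ (m + 2) * (B : ℂ) ^ (m + 1) / ((m + 1).factorial : ℂ) := by
  have hph : ∀ x : ℝ, cexp (-(2 * π * I) * B * ((x : ℂ) + y * I)) =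
      cexp ((2 * π * B * y : ℝ)) * cexp (-(2 * π * I * B) * (x : ℂ)) := by
    intro x
    rw [← Complex.exp_add]
    congr 1
    push_cast
    linear_combination (-(2 * π * B * y : ℂ)) * Complex.I_sq
  have hE : cexp ((2 * π * B * y : ℝ)) * cexp (-(2 * π * B * y : ℝ)) = 1 := by
    rw [← Complex.exp_add, add_neg_cancel, Complex.exp_zero]
  simp_rw [hph]
  simp_rw [show ∀ x : ℝ, (((x : ℂ) + y * I) ^ (m + 2))⁻¹ *
      (cexp ((2 * π * B * y : ℝ)) * cexp (-(2 * π * I * B) * (x : ℂ))) =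
      cexp ((2 * π * B * y : ℝ)) * ((((x : ℂ) + y * I) ^ (m + 2))⁻¹ *
        cexp (-(2 * π * I * B) * (x : ℂ))) from fun x => by ring]
  rw [integral_const_mul, besselMode_lipschitzIntegral m hy hB]
  linear_combination ((-(2 * π * I)) ^ (m + 2) * (B : ℂ) ^ (m + 1) / ((m + 1).factorial : ℂ)) * hE

/-! ## 2. The termwise majorant and the power series of `e(−A/τ)` -/

/-- `x + iy ≠ 0` for `y ≠ 0`. [folklore] -/
private theorem besselMode_ofReal_add_mul_I_ne_zero (x : ℝ) {y : ℝ} (hy : y ≠ 0) :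
    ((x : ℂ) + y * I) ≠ 0 := by
  intro h
  have := congrArg Complex.im h
  simp [hy] at this

/-- `‖(x+iy)^{-(n+2)}‖ ≤ y^{-n} (x²+y²)^{-1}` for `y > 0`. [folklore] -/
private theorem besselMode_norm_inv_pow_le (n : ℕ) (x : ℝ) {y : ℝ} (hy : 0 < y) :
    ‖(((x : ℂ) + y * I) ^ (n + 2))⁻¹‖ ≤ (y ^ n * (x ^ 2 + y ^ 2))⁻¹ := by
  have hsq : ‖((x : ℂ) + y * I)‖ ^ 2 = x ^ 2 + y ^ 2 := by
    rw [Complex.sq_norm, Complex.normSq_add_mul_I]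
  have hyle : y ≤ ‖((x : ℂ) + y * I)‖ := by
    simpa using Complex.im_le_norm ((x : ℂ) + y * I)
  have hpos : 0 < y ^ n * (x ^ 2 + y ^ 2) := by positivity
  rw [norm_inv, norm_pow]
  refine inv_anti₀ hpos ?_
  rw [pow_add, hsq]
  exact mul_le_mul_of_nonneg_right (pow_le_pow_left₀ hy.le hyle n) (by positivity)

/-- `|e(−B(x+iy))| = e^{2πBy}`. [folklore] -/
private theorem besselMode_norm_cexp_phase (B x y : ℝ) :
    ‖cexp (-(2 * π * I) * B * ((x : ℂ) + y * I))‖ = Real.exp (2 * π * B * y) := by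
  rw [Complex.norm_exp]
  congr 1
  simp only [neg_mul, Complex.neg_re, Complex.mul_re, Complex.mul_im, Complex.add_re,
    Complex.add_im, Complex.ofReal_re, Complex.ofReal_im, Complex.I_re, Complex.I_im,
    Complex.re_ofNat, Complex.im_ofNat]
  ring

/-- **The power series of the integrand**: for `τ = x + iy ≠ 0`,
`τ^{-2} e(−A/τ − Bτ) = Σ_j (−2πiA)^j/j! · τ^{-(j+2)} e(−Bτ)` (the exponential series of `e(−A/τ)`).
[cite: IwaniecKowalski2004, §14.2 (proof of Lemma 14.2); folklore] -/
theorem besselMode_hasSum_integrand (A B x : ℝ) {y : ℝ} (hy : y ≠ 0) :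
    HasSum (fun n : ℕ => (-(2 * π * I) * A) ^ n / (n.factorial : ℂ) *
        ((((x : ℂ) + y * I) ^ (n + 2))⁻¹ * cexp (-(2 * π * I) * B * ((x : ℂ) + y * I))))
      ((((x : ℂ) + y * I) ^ 2)⁻¹ *
        cexp (2 * π * I * (-(A : ℂ) / ((x : ℂ) + y * I) - B * ((x : ℂ) + y * I)))) := by
  have hτ := besselMode_ofReal_add_mul_I_ne_zero x hy
  set τ : ℂ := (x : ℂ) + y * I with hτ_def
  set w : ℂ := -(2 * π * I) * A * τ⁻¹ with hw_def
  have hexp : HasSum (fun n : ℕ => w ^ n / (n.factorial : ℂ)) (cexp w) := by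
    rw [Complex.exp_eq_exp_ℂ]
    exact NormedSpace.expSeries_div_hasSum_exp w
  have h := hexp.mul_right ((τ ^ 2)⁻¹ * cexp (-(2 * π * I) * B * τ))
  have hlhs : (fun n : ℕ => (-(2 * π * I) * A) ^ n / (n.factorial : ℂ) *
      ((τ ^ (n + 2))⁻¹ * cexp (-(2 * π * I) * B * τ))) =
      fun n : ℕ => w ^ n / (n.factorial : ℂ) * ((τ ^ 2)⁻¹ * cexp (-(2 * π * I) * B * τ)) := by
    funext n
    rw [hw_def, mul_pow (-(2 * π * I) * (A : ℂ)) τ⁻¹ n, inv_pow, pow_add, mul_inv]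
    ring
  have hrhs : (τ ^ 2)⁻¹ * cexp (2 * π * I * (-(A : ℂ) / τ - B * τ)) =
      cexp w * ((τ ^ 2)⁻¹ * cexp (-(2 * π * I) * B * τ)) := by
    rw [show 2 * π * I * (-(A : ℂ) / τ - B * τ) = w + -(2 * π * I) * B * τ by rw [hw_def]; ring,
      Complex.exp_add]
    ring
  rw [hlhs, hrhs]
  exact h

/-! ## 3. The mode integral -/

/-- The summand identity behind the resummation: with `q² = −(2π)²` (i.e. `q = −2πi`),
`(qA)^n/n! · q^{n+2} B^{n+1}/(n+1)! = −(−1)^n ((2π)²)^{n+1} A^n B^{n+1}/(n!(n+1)!)`. [folklore] -/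
private theorem besselMode_term_eq (q : ℂ) (hq : q ^ 2 = -((2 * π) ^ 2 : ℂ)) (A B : ℝ) (n : ℕ) :
    (q * A) ^ n / (n.factorial : ℂ) * (q ^ (n + 2) * (B : ℂ) ^ (n + 1) / ((n + 1).factorial : ℂ)) =
      ((-(-1) ^ n * ((2 * π) ^ 2) ^ (n + 1) * A ^ n * B ^ (n + 1) /
        (n.factorial * (n + 1).factorial) : ℝ) : ℂ) := by
  rw [show (q * A) ^ n / (n.factorial : ℂ) * (q ^ (n + 2) * (B : ℂ) ^ (n + 1) / ((n + 1).factorial : ℂ)) =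
      (q ^ 2) ^ (n + 1) * ((A : ℂ) ^ n * (B : ℂ) ^ (n + 1) / ((n.factorial : ℂ) * ((n + 1).factorial : ℂ)))
      by ring, hq, neg_pow, pow_succ (-1 : ℂ) n]
  push_cast
  ring

/-- The Bessel summand identity: with `r = √(AB)`, `s = √(B/A)` (`s·r = B`, `r² = AB`),
`−2π s · (−1)^n/(n!(n+1)!) · (2πr)^{2n+1} = −(−1)^n ((2π)²)^{n+1} A^n B^{n+1}/(n!(n+1)!)`. [folklore] -/
private theorem besselMode_besselTerm_eq {A B : ℝ} (hA : 0 < A) (hB : 0 < B) (n : ℕ) :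
    -(2 * π * Real.sqrt (B / A) * besselJTerm 1 (4 * π * Real.sqrt (A * B)) n) =
      -(-1) ^ n * ((2 * π) ^ 2) ^ (n + 1) * A ^ n * B ^ (n + 1) /
        (n.factorial * (n + 1).factorial) := by
  have hr2 : Real.sqrt (A * B) ^ 2 = A * B := Real.sq_sqrt (by positivity)
  have hsr : Real.sqrt (B / A) * Real.sqrt (A * B) = B := by
    rw [← Real.sqrt_mul (by positivity), show B / A * (A * B) = B * B by field_simp]
    exact Real.sqrt_mul_self hB.le
  simp only [besselJTerm]
  rw [show 4 * π * Real.sqrt (A * B) / 2 = 2 * π * Real.sqrt (A * B) by ring, pow_succ, pow_mul,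
    mul_pow (2 * π) (Real.sqrt (A * B)) 2, hr2]
  linear_combination (-(-1) ^ n * (2 * π) ^ 2 * ((2 * π) ^ 2) ^ n * A ^ n * B ^ n /
    ((n.factorial : ℝ) * ((n + 1).factorial : ℝ))) * hsr

/-- **The weight-2 Kloosterman–Bessel mode integral (Lipschitz–Hankel evaluation)**: for
`A, B, y > 0`,
`∫_ℝ (x+iy)^{-2} e(−A/(x+iy) − B(x+iy)) dx = −2π √(B/A) · J₁(4π√(AB))`, `e(z) = exp(2πiz)` —
the `x`-integral of the Fourier expansion of the weight-2 Poincaré series (Iwaniec–Kowalski, proof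
of Lemma 14.2, `k = 2`), stated exactly as the stub `stub_besselModeIntegral` of the Petersson-formula
skeleton for `KowalskiMichel2000.kowalskiMichel2000_peterssonFormula`. Proof: expand `e(−A/τ)`,
integrate termwise by `besselMode_lipschitzIntegral_line` (dominated convergence for series with the
majorant `(2πA/y)^j/j! · e^{2πBy}/(x²+y²)`), and resum the power series of the tree's `besselJ 1`.
[cite: IwaniecKowalski2004, §14.2 (proof of Lemma 14.2)] -/
theorem weightTwo_besselModeIntegral :
    ∀ (A B y : ℝ), 0 < A → 0 < B → 0 < y →
      ∫ x : ℝ, (((x : ℂ) + y * I) ^ 2)⁻¹ *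
          cexp (2 * π * I * (-(A : ℂ) / ((x : ℂ) + y * I) - B * ((x : ℂ) + y * I))) =
        ((-(2 * π * Real.sqrt (B / A) * besselJ 1 (4 * π * Real.sqrt (A * B))) : ℝ) : ℂ) := by
  intro A B y hA hB hy
  -- the terms `F n`, their integrals `T n`, and the majorant `bound n`
  set F : ℕ → ℝ → ℂ := fun n x => (-(2 * π * I) * A) ^ n / (n.factorial : ℂ) *
    ((((x : ℂ) + y * I) ^ (n + 2))⁻¹ * cexp (-(2 * π * I) * B * ((x : ℂ) + y * I))) with hF_def
  set bound : ℕ → ℝ → ℝ := fun n x => (2 * π * A / y) ^ n / (n.factorial : ℝ) *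
    (Real.exp (2 * π * B * y) * (x ^ 2 + y ^ 2)⁻¹) with hbound_def
  have hτ : ∀ x : ℝ, ((x : ℂ) + y * I) ≠ 0 := fun x => besselMode_ofReal_add_mul_I_ne_zero x hy.ne'
  -- measurability (continuity) of the terms
  have hF_meas : ∀ n, AEStronglyMeasurable (F n) volume := by
    intro n
    have hτc : Continuous fun x : ℝ => (x : ℂ) + y * I := by fun_prop
    have hc : Continuous (F n) := by
      simp only [hF_def]
      refine continuous_const.mul ((((hτc.pow (n + 2)).inv₀ fun x => pow_ne_zero _ (hτ x))).mul ?_)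
      exact Complex.continuous_exp.comp (continuous_const.mul hτc)
    exact hc.aestronglyMeasurable
  -- the majorant
  have h_bound : ∀ n, ∀ᵐ x ∂volume, ‖F n x‖ ≤ bound n x := by
    intro n
    refine Eventually.of_forall fun x => ?_
    have hq : ‖(-(2 * π * I) * A : ℂ) ^ n / (n.factorial : ℂ)‖ = (2 * π * A) ^ n / n.factorial := by
      rw [norm_div, norm_pow, Complex.norm_natCast]
      congr 2
      simp [abs_of_pos hA, abs_of_pos Real.pi_pos]
    have h1 := besselMode_norm_inv_pow_le n x hy
    have h2 := besselMode_norm_cexp_phase B x y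
    simp only [hF_def, hbound_def]
    rw [norm_mul, norm_mul, hq, h2]
    calc (2 * π * A) ^ n / (n.factorial : ℝ) *
          (‖(((x : ℂ) + y * I) ^ (n + 2))⁻¹‖ * Real.exp (2 * π * B * y))
        ≤ (2 * π * A) ^ n / (n.factorial : ℝ) *
          ((y ^ n * (x ^ 2 + y ^ 2))⁻¹ * Real.exp (2 * π * B * y)) := by gcongr
      _ = (2 * π * A / y) ^ n / (n.factorial : ℝ) * (Real.exp (2 * π * B * y) * (x ^ 2 + y ^ 2)⁻¹) := by
          rw [div_pow, mul_inv]
          have : y ^ n ≠ 0 := pow_ne_zero n hy.ne'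
          field_simp
  have bound_summable : ∀ᵐ x ∂volume, Summable fun n => bound n x :=
    Eventually.of_forall fun x =>
      (Real.summable_pow_div_factorial (2 * π * A / y)).mul_right _
  have bound_integrable : Integrable (fun x => ∑' n, bound n x) volume := by
    have e : (fun x => ∑' n, bound n x) = fun x : ℝ => (∑' n : ℕ, (2 * π * A / y) ^ n / (n.factorial : ℝ)) *
        (Real.exp (2 * π * B * y) * (x ^ 2 + y ^ 2)⁻¹) := by
      funext x
      simp only [hbound_def]
      exact tsum_mul_right
    rw [e]
    exact ((integrable_inv_sq_add_sq_of_ne_zero' hy.ne').const_mul _).const_mul _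
  -- the pointwise expansion
  have h_lim : ∀ᵐ x ∂volume, HasSum (fun n => F n x) ((((x : ℂ) + y * I) ^ 2)⁻¹ *
      cexp (2 * π * I * (-(A : ℂ) / ((x : ℂ) + y * I) - B * ((x : ℂ) + y * I)))) :=
    Eventually.of_forall fun x => besselMode_hasSum_integrand A B x hy.ne'
  -- dominated convergence for series
  have hsum := hasSum_integral_of_dominated_convergence bound hF_meas h_bound bound_summable
    bound_integrable h_lim
  -- the termwise integrals
  have hFn : ∀ n : ℕ, ∫ x, F n x = (-(2 * π * I) * A) ^ n / (n.factorial : ℂ) *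
      ((-(2 * π * I)) ^ (n + 2) * (B : ℂ) ^ (n + 1) / ((n + 1).factorial : ℂ)) := by
    intro n
    simp only [hF_def]
    rw [integral_const_mul, besselMode_lipschitzIntegral_line n hy hB]
  -- the resummation against `J₁`
  have hq2 : (-(2 * π * I) : ℂ) ^ 2 = -((2 * π) ^ 2 : ℂ) := by
    linear_combination ((2 * π) ^ 2 : ℂ) * Complex.I_sq
  have hterm : ∀ n : ℕ, ∫ x, F n x =
      ((-(2 * π * Real.sqrt (B / A) * besselJTerm 1 (4 * π * Real.sqrt (A * B)) n) : ℝ) : ℂ) := by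
    intro n
    rw [hFn n, besselMode_besselTerm_eq hA hB n]
    exact besselMode_term_eq (-(2 * π * I)) hq2 A B n
  have hR : HasSum (fun n : ℕ =>
      ((-(2 * π * Real.sqrt (B / A) * besselJTerm 1 (4 * π * Real.sqrt (A * B)) n) : ℝ) : ℂ))
      ((-(2 * π * Real.sqrt (B / A) * besselJ 1 (4 * π * Real.sqrt (A * B))) : ℝ) : ℂ) := by
    rw [Complex.hasSum_ofReal]
    have h := ((hasSum_besselJ_holds 1 (4 * π * Real.sqrt (A * B))).mul_left
      (2 * π * Real.sqrt (B / A))).neg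
    simpa [mul_assoc] using h
  have hsum' : HasSum (fun n : ℕ => ∫ x, F n x)
      ((-(2 * π * Real.sqrt (B / A) * besselJ 1 (4 * π * Real.sqrt (A * B))) : ℝ) : ℂ) := by
    simp_rw [hterm]
    exact hR
  exact hsum.unique hsum'

end Literature.NumberTheory.LFunctions

end
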